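import Summits.ResolutionOfSingularities.ResolutionOfSingularities.Theorems.NearCutForms
import HarnessLib

/-!
# NearCutForms2 — decomp-res node «NearCut» (lens-3 g22, critic row 170), tree file 2/10 of the node

Content VERBATIM from the decomp-res lens-3 g22 node `HOME/decomp-res-lens-3/g22/NearCut.lean` (pin 52e91527; HOME =
run/shared/lean/pub/decomp-res); critic row 170
BOOKED 0·0; landing orders INBOX :715 / :727 — provenance, critic text and the lens header in full in the first file
of the node, `NearCutForms`.  Namespace
`…Theorems.NearCut`; `--supports stmt-ResolutionOfSingularities-31770`; linear import chain in the lens's order.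

## This file

Continuation 2/2 of `NearCutForms` (same sections of the node, cut at the 400-line cap): carries
`eq_shear_of_isHomogeneous`, `resCone`, `degree_tsub_of_le`, `homogeneousComponent_eq_mul_resCone`,
`resLayer_eq_dehom_resCone`, `resForm_eq_translate_dehom`, `isHomogeneous_resCone`, `coeff_resCone`,
`resCone_eq_shear`, `face_resCone_succ`, `Pure`, `pure_of_repeat`, `pure_of_pure_succ`, `pure_of_plateau`,
`directrix_of_plateau`.

[WRITER NOTE (decomp-res writer g10): file split only (tree files ≤ 400 lines); namespace blocks, sections, section
variables, `open` lines and every declaration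
exactly as in the lens; the three deprecated `Finsupp.degree_add` occurrences read `map_add` (definitionally the same lemma).]

(Sources: cossart2020 (Cossart–Jannsen–Saito LNM 2270: Thm 5.40 p. 85, Defs 5.38/5.39 pp. 84–85, Thm 5.28 p. 72, Thm
5.35 / Cor 5.37); HauserPerlega2024 (Prop. 3 p. 791); Hauser2010Kangaroo (arXiv:0811.4151); Moh1987;
CossartPiltant2008 §2; Giraud1975; Hironaka1964.)
-/

noncomputable section

open MvPolynomial Finset
open Literature.AlgebraicGeometry.Resolution
open Literature.AlgebraicGeometry.Resolution.Hauser2010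
open Literature.AlgebraicGeometry.Resolution.PointBlowup
open Summit.ResolutionOfSingularities.ResolutionOfSingularities.Theses
open Summit.ResolutionOfSingularities.ResolutionOfSingularities.Theorems.TightDefectClasses
open Summit.ResolutionOfSingularities.ResolutionOfSingularities.Theorems.TightDefectStrongWalks
open Summit.ResolutionOfSingularities.ResolutionOfSingularities.Theorems.ItineraryCutClasses
open Summit.ResolutionOfSingularities.ResolutionOfSingularities.Theorems.BoundaryLedger
open Summit.ResolutionOfSingularities.ResolutionOfSingularities.Theorems.ProximityCut
open Summit.ResolutionOfSingularities.ResolutionOfSingularities.Theorems.ConeCutAxisLaw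
open Literature.AlgebraicGeometry.Resolution.WeightedBlowup
open Literature.Barriers.ResolutionOfSingularities
open Summit.ResolutionOfSingularities.ResolutionOfSingularities.Theorems.FloorCut
open Summit.ResolutionOfSingularities.ResolutionOfSingularities.Theorems.ConeCut
open Summit.ResolutionOfSingularities.ResolutionOfSingularities.Theorems.ExitLaw (fin3_cases eq_of_le_of_degree_le)
open Summit.ResolutionOfSingularities.ResolutionOfSingularities.Theorems.ShadeCut
open Summit.ResolutionOfSingularities.ResolutionOfSingularities.Theorems.TightCut
open Summit.ResolutionOfSingularities.ResolutionOfSingularities.Theorems.HoleCut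

namespace Summit.ResolutionOfSingularities.ResolutionOfSingularities.Theorems.NearCut

section Forms

variable {σ : Type*} {K : Type*} [Field K] [DecidableEq σ]

/-- **RE-HOMOGENISATION (PROVED).**  A form `R` of degree `n` is the shear of its translated dehomogenisation
`N = translate β (R|_{y_j := 1})` (`β_j = 0`) whenever `N` is again a form of degree `n`:  `R = N(y_i − β_i y_j)`.
Applied to the residual cone of a plateau move (where the CONE LAW says `N` is a form), this is the identity
`in_o(F_t) = y^{r_t} · N_t(y_i − b_t(i)·y_{j_t})`. [folklore] -/
theorem eq_shear_of_isHomogeneous [Fintype σ] (j : σ) (β : σ → K) (hβ : β j = 0) {R : MvPolynomial σ K} {n : ℕ}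
    (hR : R.IsHomogeneous n) (hN : (translate β (dehom j R)).IsHomogeneous n) :
    R = shear j β (translate β (dehom j R)) := by
  classical
  have hcomp : dehom j (shear j β (translate β (dehom j R))) = dehom j R := by
    unfold dehom shear
    rw [translate_eq_aeval, aeval_aeval', aeval_aeval', aeval_aeval']
    have hfun : (fun i => aeval (fun i => aeval (fun i => aeval (Function.update X j (1 : MvPolynomial σ K))
        (X i - C (β i) * X j : MvPolynomial σ K)) (X i + C (β i) : MvPolynomial σ K))
        (Function.update X j (1 : MvPolynomial σ K) i)) = Function.update X j 1 := by
      funext i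
      by_cases hij : i = j
      · subst hij
        rw [Function.update_self, map_one]
      · simp only [Function.update_of_ne hij, aeval_X, map_add, map_sub, map_mul, aeval_C, algebraMap_eq,
          Function.update_self]
        ring
    rw [hfun]
  ext d
  by_cases hd : d.degree = n
  · rw [← coeff_dehom_of_isHomogeneous j hR d hd, ← coeff_dehom_of_isHomogeneous j (isHomogeneous_shear j β hN)
      d hd, hcomp]
  · rw [hR.coeff_eq_zero hd, (isHomogeneous_shear j β hN).coeff_eq_zero hd]

end Forms

section Walks

variable {K : Type} [Field K] [DecidableEq K] {q : ℕ} {s₀ : State (Fin 3) K}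

/-! ## §N1 THE DIRECTRIX LAW ALONG A WALK (kernel, PROVED, hypothesis-free, every `(q, n)`)

On a plateau (constant shade `n`, orders `> q`) on which proximity repeats recur, the tangent cone of EVERY stage is
the boundary monomial times a PURE `n`-TH POWER OF ONE LINEAR FORM: `in_{o_t}(F_t) = c · y^{r_t} · ℓ_t^n`.
Mechanism (two tree laws + §N0): at a repeat the residual form `N_t` is a pure power (tree POWER LAW
`ConeCut.resForm_eq_pow_of_repeat`); purity TRANSPORTS BACKWARDS along ANY plateau move, because the `u_{j_t}`-free
face of the next residual cone is `U_t(0) · N_t` (tree RESTRICTION IDENTITY) while the next residual cone is the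
re-homogenisation (§N0) of the next residual form (tree CONE LAW) — and faces / shears of pure powers are pure powers.
So purity propagates from each repeat down to every earlier stage of the plateau. -/

/-- The RESIDUAL CONE of stage `t` at order `o`: `in_o(F_t) / y^{r_t}` (a form of degree `o − |r_t|`).
DEFINITION (support). -/
def resCone (W : ForcedWalk q s₀) (t o : ℕ) : MvPolynomial (Fin 3) K :=
  ∑ d ∈ (W.st t).F.support with d.degree = o, monomial (d - (W.st t).r) (coeff d (W.st t).F)

omit [DecidableEq K] in
/-- Degree of a difference of exponents below one another. [folklore] -/
theorem degree_tsub_of_le {σ : Type*} {r d : σ →₀ ℕ} (h : r ≤ d) : (d - r).degree = d.degree - r.degree := by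
  have e : (r + (d - r)).degree = d.degree := by rw [add_tsub_cancel_of_le h]
  rw [map_add] at e
  omega

/-- `in_o(F_t) = y^{r_t} · resCone_t`. [folklore] -/
theorem homogeneousComponent_eq_mul_resCone (hroot : IsRoot q s₀) (W : ForcedWalk q s₀) (t o : ℕ) :
    homogeneousComponent o (W.st t).F = monomial (W.st t).r 1 * resCone W t o := by
  classical
  have hsum : monomial (W.st t).r 1 * resCone W t o
      = ∑ d ∈ (W.st t).F.support with d.degree = o, monomial d (coeff d (W.st t).F) := by
    unfold resCone
    rw [Finset.mul_sum]
    refine Finset.sum_congr rfl fun d hd => ?_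
    rw [monomial_mul, one_mul, add_tsub_cancel_of_le (walk_r hroot W t d (Finset.mem_filter.mp hd).1)]
  rw [hsum]
  ext D
  rw [coeff_homogeneousComponent, coeff_sum]
  by_cases hD : D.degree = o
  · rw [if_pos hD, Finset.sum_eq_single D]
    · rw [coeff_monomial, if_pos rfl]
    · intro d _ hdD; rw [coeff_monomial, if_neg hdD]
    · intro hD'
      rw [coeff_monomial, if_pos rfl]
      by_contra hne
      exact hD' (Finset.mem_filter.mpr ⟨MvPolynomial.mem_support_iff.mpr hne, hD⟩)
  · rw [if_neg hD]
    refine (Finset.sum_eq_zero fun d hd => ?_).symm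
    rw [coeff_monomial, if_neg]
    rintro rfl
    exact hD (Finset.mem_filter.mp hd).2

/-- The residual LAYER (tree) is the dehomogenised residual CONE. [folklore] -/
theorem resLayer_eq_dehom_resCone (W : ForcedWalk q s₀) (t o : ℕ) :
    resLayer (W.j t) (W.st t) o = dehom (W.j t) (resCone W t o) := by
  classical
  unfold resLayer resCone dehom
  rw [map_sum]
  refine Finset.sum_congr rfl fun d _ => ?_
  exact (dehom_monomial (W.j t) _ _).symm

/-- The residual FORM (tree) is the translated dehomogenised residual cone. [folklore] -/
theorem resForm_eq_translate_dehom (W : ForcedWalk q s₀) (t o : ℕ) :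
    resForm W t o = translate (W.b t) (dehom (W.j t) (resCone W t o)) := by
  unfold resForm
  rw [resLayer_eq_dehom_resCone]

/-- The residual cone is a form of degree `o − |r_t|`. [folklore] -/
theorem isHomogeneous_resCone (hroot : IsRoot q s₀) (W : ForcedWalk q s₀) (t o : ℕ) :
    (resCone W t o).IsHomogeneous (o - (W.st t).r.degree) := by
  classical
  unfold resCone
  refine IsHomogeneous.sum _ _ _ fun d hd => ?_
  obtain ⟨hdF, hdo⟩ := Finset.mem_filter.mp hd
  refine isHomogeneous_monomial _ ?_
  rw [degree_tsub_of_le (walk_r hroot W t d hdF), hdo]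

/-- Coefficients of the residual cone. [folklore] -/
theorem coeff_resCone (hroot : IsRoot q s₀) (W : ForcedWalk q s₀) (t o : ℕ) (m : Fin 3 →₀ ℕ) :
    coeff m (resCone W t o) = if m.degree + (W.st t).r.degree = o then coeff ((W.st t).r + m) (W.st t).F else 0 := by
  classical
  unfold resCone
  rw [coeff_sum]
  split_ifs with hm
  · rw [Finset.sum_eq_single ((W.st t).r + m)]
    · rw [coeff_monomial, add_tsub_cancel_left, if_pos rfl]
    · intro d hd hne
      rw [coeff_monomial, if_neg]
      intro heq
      apply hne
      rw [← heq, add_tsub_cancel_of_le (walk_r hroot W t d (Finset.mem_filter.mp hd).1)]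
    · intro hmem
      rw [coeff_monomial, add_tsub_cancel_left, if_pos rfl]
      by_contra hne
      refine hmem (Finset.mem_filter.mpr ⟨MvPolynomial.mem_support_iff.mpr hne, ?_⟩)
      rw [map_add]; omega
  · refine Finset.sum_eq_zero fun d hd => ?_
    obtain ⟨hdF, hdo⟩ := Finset.mem_filter.mp hd
    rw [coeff_monomial, if_neg]
    intro heq
    apply hm
    rw [← heq, degree_tsub_of_le (walk_r hroot W t d hdF), hdo]
    have := degree_le_degree_of_le (walk_r hroot W t d hdF)
    omega

/-- **THE RESIDUAL CONE IS THE RE-HOMOGENISED RESIDUAL FORM (PROVED).**  On a plateau move from order `o > q`: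
`resCone_t = N_t(y_i − b_t(i) · y_{j_t})`. [new] [folklore] -/
theorem resCone_eq_shear (hroot : IsRoot q s₀) (W : ForcedWalk q s₀) (t : ℕ) {o : ℕ} (ho : ordZero (W.st t).F = o)
    (hqo : q < o) (hplat : (W.st (t + 1)).shade = (W.st t).shade) {n : ℕ} (hn : (W.st t).shade = (n : ℕ∞)) :
    resCone W t o = shear (W.j t) (W.b t) (resForm W t o) := by
  obtain ⟨n₁, hn₁, hon⟩ := order_eq_shade_add_degree hroot W t ho
  have hnn : n₁ = n := by have h := hn₁.symm.trans hn; exact_mod_cast h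
  have hR : (resCone W t o).IsHomogeneous n := by
    have h := isHomogeneous_resCone hroot W t o
    rwa [show o - (W.st t).r.degree = n by omega] at h
  have hN := (cone_of_plateau hroot W t ho hqo hplat hn).1
  rw [resForm_eq_translate_dehom] at hN ⊢
  exact eq_shear_of_isHomogeneous (W.j t) (W.b t) (W.onExc t) hR hN

/-- **THE FACE IDENTITY (PROVED).**  On a plateau move from order `o > q`: the `u_{j_t}`-free face of the NEXT residual
cone is the boundary unit times the residual form, `resCone_{t+1}(u_{j_t} := 0) = U_t(0) · N_t`. [new] [folklore] -/
theorem face_resCone_succ (hroot : IsRoot q s₀) (W : ForcedWalk q s₀) (t : ℕ) {o o' : ℕ}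
    (ho : ordZero (W.st t).F = o) (ho' : ordZero (W.st (t + 1)).F = o') (hqo : q < o)
    (hplat : (W.st (t + 1)).shade = (W.st t).shade) {n : ℕ} (hn : (W.st t).shade = (n : ℕ∞)) :
    face (W.j t) (resCone W (t + 1) o') = C (bUnit W t) * resForm W t o := by
  classical
  obtain ⟨n', hn', hon'⟩ := order_eq_shade_add_degree hroot W (t + 1) ho'
  have hnn : n' = n := by have h := hn'.symm.trans (hplat.trans hn); exact_mod_cast h
  have hcone := cone_of_plateau hroot W t ho hqo hplat hn
  ext m
  rw [coeff_face, coeff_C_mul]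
  split_ifs with hmj
  · rw [coeff_resCone hroot]
    split_ifs with hm
    · exact restriction_of_plateau hroot W t ho hqo hplat hn m hmj (by omega)
    · rw [hcone.1.coeff_eq_zero (d := m) (by omega), mul_zero]
  · rw [coeff_resForm_eq_zero W t o hmj, mul_zero]

/-- Stage `t` is PURE (at shade `n`): its residual form is a scalar times an `n`-th power of a linear form.
DEFINITION (support). -/
def Pure (W : ForcedWalk q s₀) (t n : ℕ) : Prop :=
  ∀ o : ℕ, ordZero (W.st t).F = o →
    ∃ (c : K) (L : MvPolynomial (Fin 3) K), L.IsHomogeneous 1 ∧ resForm W t o = C c * L ^ n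

/-- Purity at a proximity repeat (tree POWER LAW, repackaged). [folklore] -/
theorem pure_of_repeat (hroot : IsRoot q s₀) (W : ForcedWalk q s₀) (t : ℕ)
    (hbig : q < ordZero (W.st t).F) (hbig' : q < ordZero (W.st (t + 1)).F)
    (hplat : (W.st (t + 1)).shade = (W.st t).shade) (hplat' : (W.st (t + 2)).shade = (W.st (t + 1)).shade)
    {n : ℕ} (hn : (W.st t).shade = (n : ℕ∞)) (hS : StaysOnNewest W t) : Pure W t n := by
  intro o ho
  obtain ⟨o', ho', -⟩ := walk_nat hroot W (t + 1)
  have hqo : q < o := by rw [ho] at hbig; exact_mod_cast hbig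
  have hqo' : q < o' := by rw [ho'] at hbig'; exact_mod_cast hbig'
  obtain ⟨k, hki, hkj⟩ := exists_third hS.1
  obtain ⟨c, -, hc⟩ := resForm_eq_pow_of_repeat hroot W t ho ho' hqo hqo' hplat hplat' hn hS hki hkj
  exact ⟨c, _, (isHomogeneous_X K k).sub (isHomogeneous_C_mul_X _ _), hc⟩

/-- **PURITY TRANSPORTS BACKWARDS along any plateau move (PROVED).** [new] [folklore] -/
theorem pure_of_pure_succ (hroot : IsRoot q s₀) (W : ForcedWalk q s₀) (t : ℕ)
    (hbig : q < ordZero (W.st t).F) (hbig' : q < ordZero (W.st (t + 1)).F)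
    (hplat : (W.st (t + 1)).shade = (W.st t).shade) (hplat' : (W.st (t + 2)).shade = (W.st (t + 1)).shade)
    {n : ℕ} (hn : (W.st t).shade = (n : ℕ∞)) (h : Pure W (t + 1) n) : Pure W t n := by
  intro o ho
  obtain ⟨o', ho', -⟩ := walk_nat hroot W (t + 1)
  have hqo : q < o := by rw [ho] at hbig; exact_mod_cast hbig
  have hqo' : q < o' := by rw [ho'] at hbig'; exact_mod_cast hbig'
  have hn' : (W.st (t + 1)).shade = (n : ℕ∞) := hplat.trans hn
  obtain ⟨c, L, hL, hcL⟩ := h o' ho'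
  have hface := face_resCone_succ hroot W t ho ho' hqo hplat hn
  rw [resCone_eq_shear hroot W (t + 1) ho' hqo' hplat' hn', hcL] at hface
  -- `face ∘ shear` is a substitution by linear forms
  unfold face shear at hface
  rw [aeval_aeval'] at hface
  have hupd : ∀ l, (Function.update X (W.j t) (0 : MvPolynomial (Fin 3) K) l).IsHomogeneous 1 := by
    intro l
    by_cases hl : l = W.j t
    · subst hl; rw [Function.update_self]; exact isHomogeneous_zero _ _ _
    · rw [Function.update_of_ne hl]; exact isHomogeneous_X K l
  obtain ⟨L', hL', hid⟩ := aeval_pure (K := K)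
    (fun i => aeval (Function.update X (W.j t) 0) (X i - C (W.b (t + 1) i) * X (W.j (t + 1))))
    (fun i => by
      have h1 : (X i - C (W.b (t + 1) i) * X (W.j (t + 1)) : MvPolynomial (Fin 3) K).IsHomogeneous 1 :=
        (isHomogeneous_X K i).sub (isHomogeneous_C_mul_X _ _)
      have h2 := h1.aeval (Function.update X (W.j t) (0 : MvPolynomial (Fin 3) K)) hupd
      rwa [one_mul] at h2) hL n (c := c)
  rw [hid] at hface
  refine ⟨(bUnit W t)⁻¹ * c, L', hL', ?_⟩
  have hb := bUnit_ne_zero W t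
  calc resForm W t o = C (bUnit W t)⁻¹ * (C (bUnit W t) * resForm W t o) := by
        rw [← mul_assoc, ← map_mul, inv_mul_cancel₀ hb, map_one, one_mul]
    _ = C ((bUnit W t)⁻¹ * c) * L' ^ n := by rw [← hface, ← mul_assoc, ← map_mul]

/-- **EVERY STAGE OF A RECURRENT PLATEAU IS PURE (PROVED)** — induction on the distance to the next repeat.
[new] [folklore] -/
theorem pure_of_plateau (hroot : IsRoot q s₀) (W : ForcedWalk q s₀) (N : ℕ)
    (hplat : ∀ t, N ≤ t → (W.st (t + 1)).shade = (W.st t).shade)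
    (hbig : ∀ t, N ≤ t → q < ordZero (W.st t).F) (hrec : ∀ M : ℕ, ∃ t, M ≤ t ∧ StaysOnNewest W t)
    {n : ℕ} (hn : (W.st N).shade = (n : ℕ∞)) : ∀ t, N ≤ t → Pure W t n := by
  have hshade : ∀ t, N ≤ t → (W.st t).shade = (n : ℕ∞) := by
    intro t ht
    induction t, ht using Nat.le_induction with
    | base => exact hn
    | succ t ht ih => exact (hplat t ht).trans ih
  -- induction on the distance `d` to a repeat at or after `t`
  have key : ∀ d t, N ≤ t → (∃ t₂, t ≤ t₂ ∧ t₂ ≤ t + d ∧ StaysOnNewest W t₂) → Pure W t n := by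
    intro d
    induction d with
    | zero =>
      intro t ht ⟨t₂, h1, h2, hS⟩
      have h12 : t₂ = t := by omega
      rw [h12] at hS
      exact pure_of_repeat hroot W t (hbig t ht) (hbig (t + 1) (by omega)) (hplat t ht) (hplat (t + 1) (by omega))
        (hshade t ht) hS
    | succ d ih =>
      intro t ht ⟨t₂, h1, h2, hS⟩
      by_cases h12 : t₂ = t
      · rw [h12] at hS
        exact pure_of_repeat hroot W t (hbig t ht) (hbig (t + 1) (by omega)) (hplat t ht) (hplat (t + 1) (by omega))
          (hshade t ht) hS
      · exact pure_of_pure_succ hroot W t (hbig t ht) (hbig (t + 1) (by omega)) (hplat t ht)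
          (hplat (t + 1) (by omega)) (hshade t ht) (ih (t + 1) (by omega) ⟨t₂, by omega, by omega, hS⟩)
  intro t ht
  obtain ⟨t₂, ht₂, hS⟩ := hrec t
  exact key (t₂ - t) t ht ⟨t₂, ht₂, by omega, hS⟩

/-- **THE DIRECTRIX LAW ALONG A WALK (PROVED, hypothesis-free, every `(q, n)`).**  On a plateau of shade `n` with all
orders `> q` on which proximity repeats recur, the degree-`o_t` tangent cone of EVERY stage is
`in_{o_t}(F_t) = c · y^{r_t} · ℓ^n` with `c ≠ 0` and `ℓ ≠ 0` a linear form: ONE-DIMENSIONAL DIRECTRIX, `e = ē`-type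
invariant of the residual cone equal to `2` in CJS's language (the residual cone is an `n`-fold PLANE). [new] [folklore] -/
theorem directrix_of_plateau (hroot : IsRoot q s₀) (W : ForcedWalk q s₀) (N : ℕ)
    (hplat : ∀ t, N ≤ t → (W.st (t + 1)).shade = (W.st t).shade)
    (hbig : ∀ t, N ≤ t → q < ordZero (W.st t).F) (hrec : ∀ M : ℕ, ∃ t, M ≤ t ∧ StaysOnNewest W t)
    {n : ℕ} (hn : (W.st N).shade = (n : ℕ∞)) (t : ℕ) (ht : N ≤ t) (o : ℕ) (ho : ordZero (W.st t).F = o) :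
    ∃ (c : K) (ℓ : MvPolynomial (Fin 3) K), c ≠ 0 ∧ ℓ.IsHomogeneous 1 ∧ ℓ ≠ 0 ∧
      homogeneousComponent o (W.st t).F = C c * (monomial (W.st t).r 1 * ℓ ^ n) := by
  classical
  have hshade : ∀ t, N ≤ t → (W.st t).shade = (n : ℕ∞) := by
    intro t ht
    induction t, ht using Nat.le_induction with
    | base => exact hn
    | succ t ht ih => exact (hplat t ht).trans ih
  obtain ⟨c, L, hL, hcL⟩ := pure_of_plateau hroot W N hplat hbig hrec hn t ht o ho
  have hqo : q < o := by have h := hbig t ht; rw [ho] at h; exact_mod_cast h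
  have hcone := resCone_eq_shear hroot W t ho hqo (hplat t ht) (hshade t ht)
  rw [hcL] at hcone
  unfold shear at hcone
  rw [map_mul, map_pow, aeval_C, algebraMap_eq] at hcone
  set ℓ : MvPolynomial (Fin 3) K := aeval (fun i => X i - C (W.b t i) * X (W.j t)) L with hℓ
  have hℓ1 : ℓ.IsHomogeneous 1 := by
    have h := hL.aeval (fun i => X i - C (W.b t i) * X (W.j t))
      (fun i => (isHomogeneous_X K i).sub (isHomogeneous_C_mul_X _ _))
    rwa [one_mul] at h
  have hid : homogeneousComponent o (W.st t).F = C c * (monomial (W.st t).r 1 * ℓ ^ n) := by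
    rw [homogeneousComponent_eq_mul_resCone hroot, hcone]; ring
  -- non-vanishing: `F_t` has a monomial of degree `o_t`
  have hne : homogeneousComponent o (W.st t).F ≠ 0 := by
    obtain ⟨⟨d, hd, hdeg⟩, -⟩ := (ordZero_eq_nat_iff _ _).mp ho
    intro h0
    have := congrArg (coeff d) h0
    rw [coeff_homogeneousComponent, if_pos hdeg, coeff_zero] at this
    exact hd this
  by_cases hn0 : n = 0
  · -- degenerate bookkeeping case (a shade-0 plateau): any non-zero linear form will do
    subst hn0
    have hX : (X 0 : MvPolynomial (Fin 3) K) ≠ 0 := X_ne_zero _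
    refine ⟨c, X 0, ?_, isHomogeneous_X K 0, hX, ?_⟩
    · rintro rfl; apply hne; rw [hid, map_zero, zero_mul]
    · rw [hid, pow_zero, pow_zero]
  · refine ⟨c, ℓ, ?_, hℓ1, ?_, hid⟩
    · rintro rfl; apply hne; rw [hid, map_zero, zero_mul]
    · rintro h0; apply hne; rw [hid, h0, zero_pow hn0, mul_zero, mul_zero]

end Walks

end Summit.ResolutionOfSingularities.ResolutionOfSingularities.Theorems.NearCut
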